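import Summits.NavierStokesRegularity.NavierStokesRegularity.Theorems.LerayQuarterDissipationFiniteDissipationLiouvilleUnidirectionalFloor
import Literature.Analysis.FluidPDE.BarkerPrange2020VorticityAlignmentTypeIHolds
import HarnessLib

/-!
# Crux `FiniteDissipationLiouville` (stmt-NavierStokesRegularity-22144): the LOCAL
# unidirectionality leaf — a slice unidirectional on ANY open set kills a finite-dissipation
# Type-I profile; the unidirectionality floor holds in EVERY similarity ball

Theorems file of route `LerayQuarterDissipation` (lead prover ns-lqd-lead g8; `--supports` the
crux, line `birth`; portrait facts for the registered stub `stub_envelopeCriticalLiouville`).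
Navier–Stokes regularity is NOT proved by anything here; no summit is.

Localisation of `…UnidirectionalFloor` by the space analyticity of the slices:

* `parallel_of_parallel_on_open` — an analytic field parallel to a fixed line on a non-empty open
  set is parallel to it everywhere (identity theorem for `V − ⟪e,V⟫e/‖e‖²`);
* `slice_eq_zero_of_velocity_parallel_on_open` — a member of `𝒟_{C,K}` whose velocity at ONE
  instant is parallel to one fixed line on SOME non-empty open set vanishes at that instant;
* `false_of_unidirectional_seq_local`, `unidirectionality_leaf_local` — **for all `C, K` and every
  similarity radius `r > 0` there is `δ = δ(C,K,r) > 0` such that `δ`-coherence modulo sign of the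
  velocity direction on the `δ`-fast part of `B(0, r√(−t))` at ONE instant forces boundedness**;
* `unidirectionality_floor_local` — **every singular member carries, at EVERY instant and in EVERY
  similarity ball `B(0, r√(−t))`, two `δ`-fast points with velocity directions `δ`-apart mod
  sign** (parallel shear flow excluded at every scale around the singular point).

HONEST FRAMING. `δ(C,K,r)` by compactness; portrait fact only.

References: Koch–Nadirashvili–Seregin–Šverák 2009, §4; Lemarié-Rieusset 2016, Thm. 9.12.
-/

noncomputable section

-- the summit and its single sub-problem share the name (CONVENTIONS §1), as in every Theorems file
set_option linter.dupNamespace false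

namespace Summit.NavierStokesRegularity.NavierStokesRegularity.Theorems.FiniteDissipationLiouville.Unidirectional

open MeasureTheory Set Filter Topology Metric Function
open Literature.Analysis Literature.Analysis.FluidPDE
open Summit.NavierStokesRegularity.NavierStokesRegularity.Theorems.FiniteDissipationLiouville
open scoped ENNReal NNReal RealInnerProductSpace

/-! ### Parallelism on an open set -/

/-- **Globalisation by analyticity (field version)**: an analytic field on `ℝ³` parallel to a fixed
vector `e` on a non-empty open set (`V = a(y) e` there, signs free, `a = 0` allowed) is parallel to
`e` everywhere (the analytic map `V − ⟪e, V⟫ e/‖e‖²` vanishes on the open set, hence on the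
connected space; for `e = 0` the identity theorem for `V` itself). Field analogue of the tree's
`curl_parallel_of_parallel_on_open`. [cite: LemarieRieusset2016, Thm. 9.12 (analyticity) with the identity theorem] -/
theorem parallel_of_parallel_on_open
    {V : EuclideanSpace ℝ (Fin 3) → EuclideanSpace ℝ (Fin 3)} (hV : AnalyticOnNhd ℝ V univ)
    {S : Set (EuclideanSpace ℝ (Fin 3))} (hS : IsOpen S) (hne : S.Nonempty)
    {e : EuclideanSpace ℝ (Fin 3)} (h : ∀ y ∈ S, ∃ a : ℝ, V y = a • e) :
    ∀ y, ∃ a : ℝ, V y = a • e := by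
  obtain ⟨z₀, hz₀⟩ := hne
  by_cases he : e = 0
  · have h0 : ∀ y ∈ S, V y = 0 := fun y hy => by
      obtain ⟨a, ha⟩ := h y hy
      rw [ha, he, smul_zero]
    have hev : V =ᶠ[𝓝 z₀] 0 := eventuallyEq_of_mem (hS.mem_nhds hz₀) h0
    intro y
    refine ⟨0, ?_⟩
    rw [zero_smul]
    exact hV.eqOn_zero_of_preconnected_of_eventuallyEq_zero isPreconnected_univ (mem_univ z₀) hev
      (mem_univ y)
  have hne2 : ‖e‖ ^ 2 ≠ 0 := pow_ne_zero 2 (norm_ne_zero_iff.2 he)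
  set L : EuclideanSpace ℝ (Fin 3) →L[ℝ] EuclideanSpace ℝ (Fin 3) :=
    ContinuousLinearMap.id ℝ (EuclideanSpace ℝ (Fin 3)) -
      (innerSL ℝ e).smulRight ((‖e‖ ^ 2)⁻¹ • e) with hL_def
  have hL : ∀ v, L v = v - ⟪e, v⟫ • ((‖e‖ ^ 2)⁻¹ • e) := fun v => by
    rw [hL_def]
    simp only [_root_.sub_apply, ContinuousLinearMap.id_apply,
      ContinuousLinearMap.smulRight_apply, innerSL_apply_apply]
  have hF : AnalyticOnNhd ℝ (fun y => L (V y)) univ := L.comp_analyticOnNhd hV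
  have hF0 : ∀ y ∈ S, L (V y) = 0 := by
    intro y hy
    obtain ⟨a, ha⟩ := h y hy
    rw [hL, ha, inner_smul_right, real_inner_self_eq_norm_sq, smul_smul,
      mul_assoc, mul_inv_cancel₀ hne2, mul_one, sub_self]
  have hev : (fun y => L (V y)) =ᶠ[𝓝 z₀] 0 := eventuallyEq_of_mem (hS.mem_nhds hz₀) hF0
  intro y
  have hy : L (V y) = 0 :=
    hF.eqOn_zero_of_preconnected_of_eventuallyEq_zero isPreconnected_univ (mem_univ z₀) hev
      (mem_univ y)
  rw [hL, sub_eq_zero, smul_smul] at hy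
  exact ⟨⟪e, V y⟫ * (‖e‖ ^ 2)⁻¹, hy⟩

/-- **A member of `𝒟_{C,K}` whose velocity at ONE instant is parallel to one fixed line on SOME
non-empty open set vanishes at that instant** (analytic globalisation, then
`slice_eq_zero_of_velocity_parallel`). [cite: LemarieRieusset2016, Thm. 9.12] [cite: KochNadirashviliSereginSverak2009, Thm 5.1 (arXiv:0709.3599 p. 9)] -/
theorem slice_eq_zero_of_velocity_parallel_on_open {C K : ℝ}
    {w : ℝ → EuclideanSpace ℝ (Fin 3) → EuclideanSpace ℝ (Fin 3)}
    (hw : IsTypeIAncientMild C w)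
    (hlaw : ∀ s : ℝ, s < 0 → ∫⁻ x, ‖fderiv ℝ (w s) x‖ₑ ^ 2 ≤ ENNReal.ofReal (K / Real.sqrt (-s)))
    {s : ℝ} (hs : s < 0) {S : Set (EuclideanSpace ℝ (Fin 3))} (hS : IsOpen S) (hne : S.Nonempty)
    (e : EuclideanSpace ℝ (Fin 3)) (hpar : ∀ x ∈ S, ∃ c : ℝ, w s x = c • e) :
    ∀ x, w s x = 0 :=
  slice_eq_zero_of_velocity_parallel hw hlaw hs e
    (parallel_of_parallel_on_open (hw.analyticOnNhd_slice_univ hs) hS hne hpar)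

/-! ### The local compactness core -/

/-- **No sequence of singular members of `𝒟_{C,K}` is asymptotically unidirectional (mod sign) on a
FIXED ball `B(0,r)` above vanishing levels at `t = −1`**: the KNSS limit either vanishes on
`B(0,r)` at `t = −1` (then identically, by analyticity) or has a point of `B(0,r)` with non-zero
velocity around which, on the open set `{w ≠ 0} ∩ B(0,r)`, the velocity is parallel to one line;
analyticity globalises and the slice vanishes. [cite: KochNadirashviliSereginSverak2009, §4 (arXiv:0709.3599 p. 8)] -/
theorem false_of_unidirectional_seq_local {C K r : ℝ} (hr : 0 < r)
    {w : ℕ → ℝ → EuclideanSpace ℝ (Fin 3) → EuclideanSpace ℝ (Fin 3)}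
    (hwk : ∀ k, IsTypeIAncientMild C (w k))
    (hlaw : ∀ k, ∀ s : ℝ, s < 0 →
      ∫⁻ x, ‖fderiv ℝ (w k s) x‖ₑ ^ 2 ≤ ENNReal.ofReal (K / Real.sqrt (-s)))
    (hsing : ∀ k, ∀ ρ > 0, ∀ M : ℝ, ∃ t ∈ Ioo (-(ρ ^ 2)) (0 : ℝ),
      ∃ x ∈ ball (0 : EuclideanSpace ℝ (Fin 3)) ρ, M < ‖w k t x‖)
    (halign : ∀ k : ℕ, ∀ x ∈ ball (0 : EuclideanSpace ℝ (Fin 3)) r,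
      ∀ y ∈ ball (0 : EuclideanSpace ℝ (Fin 3)) r,
        1 / ((k : ℝ) + 1) < ‖w k (-1) x‖ → 1 / ((k : ℝ) + 1) < ‖w k (-1) y‖ →
        min ‖‖w k (-1) x‖⁻¹ • w k (-1) x - ‖w k (-1) y‖⁻¹ • w k (-1) y‖
            ‖‖w k (-1) x‖⁻¹ • w k (-1) x + ‖w k (-1) y‖⁻¹ • w k (-1) y‖ ≤ 1 / ((k : ℝ) + 1)) :
    False := by
  obtain ⟨ψ, hψ, W, hW, hunif, hval, hgrad⟩ := Compactness.seqLimit hwk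
  have hψt : Tendsto ψ atTop atTop := hψ.tendsto_atTop
  have hWlaw : ∀ s : ℝ, s < 0 →
      ∫⁻ x, ‖fderiv ℝ (W s) x‖ₑ ^ 2 ≤ ENNReal.ofReal (K / Real.sqrt (-s)) :=
    Compactness.law_of_seqLimit (Kinf := K) (Kk := fun _ => K) hψt hlaw
      (fun ε hε => Eventually.of_forall fun _ => by linarith) hgrad
  have hWsing := Compactness.persistent_singularity_seq (w := fun j => w (ψ j))
    (fun j => hwk (ψ j)) (fun j => hlaw (ψ j)) (fun j => hsing (ψ j)) hW hunif
  have h1 : (-1 : ℝ) < 0 := by norm_num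
  have han : AnalyticOnNhd ℝ (W (-1)) univ := hW.analyticOnNhd_slice_univ h1
  have hv : ∀ z, Tendsto (fun j => w (ψ j) (-1) z) atTop (𝓝 (W (-1) z)) := fun z => hval (-1) h1 z
  have hδ : Tendsto (fun j => 1 / ((ψ j : ℝ) + 1)) atTop (𝓝 0) :=
    (tendsto_one_div_add_atTop_nhds_zero_nat (𝕜 := ℝ)).comp hψt
  have hev_level : ∀ z : EuclideanSpace ℝ (Fin 3), W (-1) z ≠ 0 → ∀ᶠ j in atTop,
      1 / ((ψ j : ℝ) + 1) < ‖w (ψ j) (-1) z‖ := by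
    intro z hz
    have hpos : 0 < ‖W (-1) z‖ / 2 := by positivity
    have h2 : ∀ᶠ j in atTop, ‖W (-1) z‖ / 2 < ‖w (ψ j) (-1) z‖ :=
      ((hv z).norm).eventually (lt_mem_nhds (by linarith [norm_pos_iff.2 hz]))
    filter_upwards [h2, hδ.eventually (gt_mem_nhds hpos)] with j hj hj'
    exact hj'.trans hj
  -- Case A: the limit slice vanishes on `B(0,r)`, hence identically (analyticity)
  by_cases hA : ∀ z ∈ ball (0 : EuclideanSpace ℝ (Fin 3)) r, W (-1) z = 0
  · have hev : W (-1) =ᶠ[𝓝 (0 : EuclideanSpace ℝ (Fin 3))] 0 :=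
      eventuallyEq_of_mem (ball_mem_nhds 0 hr) hA
    have h0 : ∀ z, W (-1) z = 0 := fun z =>
      han.eqOn_zero_of_preconnected_of_eventuallyEq_zero isPreconnected_univ (mem_univ 0) hev
        (mem_univ z)
    exact CalmSlice.not_singular_of_zero_slice hW h1 h0 hWsing
  -- Case B: a point of `B(0,r)` with non-zero limit velocity fixes the direction `e`
  push Not at hA
  obtain ⟨z₀, hz₀r, hz₀⟩ := hA
  set e : EuclideanSpace ℝ (Fin 3) := ‖W (-1) z₀‖⁻¹ • W (-1) z₀ with he_def
  set S : Set (EuclideanSpace ℝ (Fin 3)) :=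
    {z | W (-1) z ≠ 0} ∩ ball (0 : EuclideanSpace ℝ (Fin 3)) r with hS_def
  have hS : IsOpen S :=
    (isOpen_ne_fun (hW.contDiff_slice h1).continuous continuous_const).inter isOpen_ball
  have hSne : S.Nonempty := ⟨z₀, hz₀, hz₀r⟩
  have hparS : ∀ z ∈ S, ∃ c : ℝ, W (-1) z = c • e := by
    rintro z ⟨hz, hzr⟩
    have hξz : Tendsto (fun j => ‖w (ψ j) (-1) z‖⁻¹ • w (ψ j) (-1) z) atTop
        (𝓝 (‖W (-1) z‖⁻¹ • W (-1) z)) := VorticityAlignment.tendsto_unitDir (hv z) hz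
    have hξz₀ : Tendsto (fun j => ‖w (ψ j) (-1) z₀‖⁻¹ • w (ψ j) (-1) z₀) atTop (𝓝 e) := by
      rw [he_def]
      exact VorticityAlignment.tendsto_unitDir (hv z₀) hz₀
    have hmin : Tendsto (fun j =>
        min ‖‖w (ψ j) (-1) z‖⁻¹ • w (ψ j) (-1) z - ‖w (ψ j) (-1) z₀‖⁻¹ • w (ψ j) (-1) z₀‖
          ‖‖w (ψ j) (-1) z‖⁻¹ • w (ψ j) (-1) z + ‖w (ψ j) (-1) z₀‖⁻¹ • w (ψ j) (-1) z₀‖)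
        atTop (𝓝 (min ‖‖W (-1) z‖⁻¹ • W (-1) z - e‖ ‖‖W (-1) z‖⁻¹ • W (-1) z + e‖)) :=
      ((hξz.sub hξz₀).norm).min ((hξz.add hξz₀).norm)
    have hle : ∀ᶠ j in atTop,
        min ‖‖w (ψ j) (-1) z‖⁻¹ • w (ψ j) (-1) z - ‖w (ψ j) (-1) z₀‖⁻¹ • w (ψ j) (-1) z₀‖
          ‖‖w (ψ j) (-1) z‖⁻¹ • w (ψ j) (-1) z + ‖w (ψ j) (-1) z₀‖⁻¹ • w (ψ j) (-1) z₀‖ ≤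
          1 / ((ψ j : ℝ) + 1) := by
      filter_upwards [hev_level z hz, hev_level z₀ hz₀] with j hl hl₀
      exact halign (ψ j) z hzr z₀ hz₀r hl hl₀
    have hmin0 : min ‖‖W (-1) z‖⁻¹ • W (-1) z - e‖ ‖‖W (-1) z‖⁻¹ • W (-1) z + e‖ ≤ 0 :=
      le_of_tendsto_of_tendsto hmin hδ hle
    have hωz : W (-1) z = ‖W (-1) z‖ • (‖W (-1) z‖⁻¹ • W (-1) z) := by
      rw [smul_smul, mul_inv_cancel₀ (norm_ne_zero_iff.2 hz), one_smul]
    rcases le_total ‖‖W (-1) z‖⁻¹ • W (-1) z - e‖ ‖‖W (-1) z‖⁻¹ • W (-1) z + e‖ with hc | hc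
    · rw [min_eq_left hc] at hmin0
      have : ‖W (-1) z‖⁻¹ • W (-1) z = e := sub_eq_zero.1 (norm_le_zero_iff.1 hmin0)
      refine ⟨‖W (-1) z‖, ?_⟩
      conv_lhs => rw [hωz, this]
    · rw [min_eq_right hc] at hmin0
      have : ‖W (-1) z‖⁻¹ • W (-1) z = -e :=
        eq_neg_of_add_eq_zero_left (norm_le_zero_iff.1 hmin0)
      refine ⟨-‖W (-1) z‖, ?_⟩
      conv_lhs => rw [hωz, this]
      rw [smul_neg, neg_smul]
  exact CalmSlice.not_singular_of_zero_slice hW h1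
    (slice_eq_zero_of_velocity_parallel_on_open hW hWlaw h1 hS hSne e hparS) hWsing

/-! ### The local leaf and the local floor -/

/-- **LOCAL ONE-SLICE UNIDIRECTIONALITY LEAF.** For all `C, K` and every similarity radius `r > 0`
there is `δ = δ(C,K,r) > 0` such that a member of `𝒟_{C,K}` having ONE instant `t < 0` at which
the velocity direction is `δ`-coherent modulo sign at all pairs of points of `B(0, r√(−t))` with
`√(−t)‖w‖ > δ` is bounded on some backward cylinder at the origin.
[cite: KochNadirashviliSereginSverak2009, §4 (arXiv:0709.3599 p. 8)] -/
theorem unidirectionality_leaf_local : ∀ (C K r : ℝ), 0 < r → ∃ δ > 0,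
    ∀ (w : ℝ → EuclideanSpace ℝ (Fin 3) → EuclideanSpace ℝ (Fin 3)),
      IsTypeIAncientMild C w →
      (∀ s : ℝ, s < 0 → ∫⁻ x, ‖fderiv ℝ (w s) x‖ₑ ^ 2 ≤ ENNReal.ofReal (K / Real.sqrt (-s))) →
      (∃ t < 0, ∀ x ∈ ball (0 : EuclideanSpace ℝ (Fin 3)) (r * Real.sqrt (-t)),
        ∀ y ∈ ball (0 : EuclideanSpace ℝ (Fin 3)) (r * Real.sqrt (-t)),
          δ < Real.sqrt (-t) * ‖w t x‖ → δ < Real.sqrt (-t) * ‖w t y‖ →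
          min ‖‖w t x‖⁻¹ • w t x - ‖w t y‖⁻¹ • w t y‖ ‖‖w t x‖⁻¹ • w t x + ‖w t y‖⁻¹ • w t y‖ ≤ δ) →
      ¬ (∀ ρ > 0, ∀ M : ℝ, ∃ t ∈ Ioo (-(ρ ^ 2)) (0 : ℝ),
        ∃ x ∈ ball (0 : EuclideanSpace ℝ (Fin 3)) ρ, M < ‖w t x‖) := by
  intro C K r hr
  by_contra hcon
  push Not at hcon
  choose w' hw' hlaw' hq' hsing' using hcon
  choose t' ht' hq' using hq'
  have hpos : ∀ k : ℕ, (0 : ℝ) < 1 / ((k : ℝ) + 1) := fun k => by positivity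
  set w : ℕ → ℝ → EuclideanSpace ℝ (Fin 3) → EuclideanSpace ℝ (Fin 3) :=
    fun k => w' _ (hpos k) with hw_def
  have hw : ∀ k, IsTypeIAncientMild C (w k) := fun k => hw' _ (hpos k)
  have hlaw := fun k => hlaw' _ (hpos k)
  have hsing := fun k => hsing' _ (hpos k)
  set t : ℕ → ℝ := fun k => t' _ (hpos k) with ht_def
  have ht : ∀ k, t k < 0 := fun k => ht' _ (hpos k)
  have hq := fun k => hq' _ (hpos k)
  set c : ℕ → ℝ := fun k => Real.sqrt (-t k) with hc_def
  have hc : ∀ k, 0 < c k := fun k => Real.sqrt_pos.2 (neg_pos.2 (ht k))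
  have hc2 : ∀ k, c k ^ 2 = -t k := fun k => Real.sq_sqrt (neg_nonneg.2 (ht k).le)
  set v : ℕ → ℝ → EuclideanSpace ℝ (Fin 3) → EuclideanSpace ℝ (Fin 3) :=
    fun k => nsRescale (c k) (w k) with hv_def
  have hv : ∀ k, IsTypeIAncientMild C (v k) := fun k => isTypeIAncientMild_nsRescale (hw k) (hc k)
  have hvlaw : ∀ k, ∀ s : ℝ, s < 0 →
      ∫⁻ x, ‖fderiv ℝ (v k s) x‖ₑ ^ 2 ≤ ENNReal.ofReal (K / Real.sqrt (-s)) :=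
    fun k => RecurrentReductionD.dissipationLaw_nsRescale (hlaw k) (hc k)
  have hvsing : ∀ k, ∀ ρ > 0, ∀ M : ℝ, ∃ t ∈ Ioo (-(ρ ^ 2)) (0 : ℝ),
      ∃ x ∈ ball (0 : EuclideanSpace ℝ (Fin 3)) ρ, M < ‖v k t x‖ :=
    fun k => RecurrentReductionD.singularAtOrigin_nsRescale (hsing k) (hc k)
  have e1 : ∀ k, c k ^ 2 * (-1 : ℝ) = t k := fun k => by rw [hc2]; ring
  have hvapp : ∀ (k : ℕ) (z : EuclideanSpace ℝ (Fin 3)), v k (-1) z = c k • w k (t k) (c k • z) := by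
    intro k z
    rw [hv_def]
    dsimp only
    rw [nsRescale_apply, e1]
  have hball : ∀ k : ℕ, ∀ z ∈ ball (0 : EuclideanSpace ℝ (Fin 3)) r,
      c k • z ∈ ball (0 : EuclideanSpace ℝ (Fin 3)) (r * Real.sqrt (-t k)) := by
    intro k z hz
    rw [mem_ball_zero_iff] at hz ⊢
    rw [norm_smul, Real.norm_of_nonneg (hc k).le, hc_def, mul_comm]
    exact mul_lt_mul_of_pos_right hz (hc k)
  have hnorm : ∀ (k : ℕ) (z : EuclideanSpace ℝ (Fin 3)),
      ‖v k (-1) z‖ = Real.sqrt (-t k) * ‖w k (t k) (c k • z)‖ := by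
    intro k z
    rw [hvapp, norm_smul, Real.norm_of_nonneg (hc k).le]
  have hdir : ∀ (k : ℕ) (z : EuclideanSpace ℝ (Fin 3)),
      ‖v k (-1) z‖⁻¹ • v k (-1) z = ‖w k (t k) (c k • z)‖⁻¹ • w k (t k) (c k • z) := by
    intro k z
    rw [hvapp, norm_smul, Real.norm_of_nonneg (hc k).le, smul_smul, mul_inv, mul_comm (c k)⁻¹,
      mul_assoc, inv_mul_cancel₀ (hc k).ne', mul_one]
  have halign : ∀ k : ℕ, ∀ x ∈ ball (0 : EuclideanSpace ℝ (Fin 3)) r,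
      ∀ y ∈ ball (0 : EuclideanSpace ℝ (Fin 3)) r,
        1 / ((k : ℝ) + 1) < ‖v k (-1) x‖ → 1 / ((k : ℝ) + 1) < ‖v k (-1) y‖ →
        min ‖‖v k (-1) x‖⁻¹ • v k (-1) x - ‖v k (-1) y‖⁻¹ • v k (-1) y‖
            ‖‖v k (-1) x‖⁻¹ • v k (-1) x + ‖v k (-1) y‖⁻¹ • v k (-1) y‖ ≤ 1 / ((k : ℝ) + 1) := by
    intro k x hx y hy hlx hly
    rw [hnorm] at hlx hly
    rw [hdir, hdir]
    exact hq k (c k • x) (hball k x hx) (c k • y) (hball k y hy) hlx hly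
  exact false_of_unidirectional_seq_local hr hv hvlaw hvsing halign

/-- **LOCAL UNIDIRECTIONALITY FLOOR** (portrait clause of the registered stub
`stub_envelopeCriticalLiouville`): for all `C, K` and every similarity radius `r > 0` there is
`δ = δ(C,K,r) > 0` such that every SINGULAR member of `𝒟_{C,K}` has, at EVERY instant `t < 0`,
two points of `B(0, r√(−t))` with `√(−t)‖w‖ > δ` whose velocity directions are `δ`-apart modulo
sign. [cite: KochNadirashviliSereginSverak2009, §4 (arXiv:0709.3599 p. 8)] -/
theorem unidirectionality_floor_local : ∀ (C K r : ℝ), 0 < r → ∃ δ > 0,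
    ∀ (w : ℝ → EuclideanSpace ℝ (Fin 3) → EuclideanSpace ℝ (Fin 3)),
      IsTypeIAncientMild C w →
      (∀ s : ℝ, s < 0 → ∫⁻ x, ‖fderiv ℝ (w s) x‖ₑ ^ 2 ≤ ENNReal.ofReal (K / Real.sqrt (-s))) →
      (∀ ρ > 0, ∀ M : ℝ, ∃ t ∈ Ioo (-(ρ ^ 2)) (0 : ℝ),
        ∃ x ∈ ball (0 : EuclideanSpace ℝ (Fin 3)) ρ, M < ‖w t x‖) →
      ∀ t < 0, ∃ x ∈ ball (0 : EuclideanSpace ℝ (Fin 3)) (r * Real.sqrt (-t)),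
        ∃ y ∈ ball (0 : EuclideanSpace ℝ (Fin 3)) (r * Real.sqrt (-t)),
          δ < Real.sqrt (-t) * ‖w t x‖ ∧ δ < Real.sqrt (-t) * ‖w t y‖ ∧
          δ < ‖‖w t x‖⁻¹ • w t x - ‖w t y‖⁻¹ • w t y‖ ∧
          δ < ‖‖w t x‖⁻¹ • w t x + ‖w t y‖⁻¹ • w t y‖ := by
  intro C K r hr
  obtain ⟨δ, hδ, h⟩ := unidirectionality_leaf_local C K r hr
  refine ⟨δ, hδ, fun w hw hlaw hsing t ht => ?_⟩
  by_contra hcon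
  push Not at hcon
  refine h w hw hlaw ⟨t, ht, fun x hx y hy hlx hly => ?_⟩ hsing
  rcases le_or_gt ‖‖w t x‖⁻¹ • w t x - ‖w t y‖⁻¹ • w t y‖ δ with h1 | h1
  · exact (min_le_left _ _).trans h1
  · exact (min_le_right _ _).trans (hcon x hx y hy hlx hly h1)

end Summit.NavierStokesRegularity.NavierStokesRegularity.Theorems.FiniteDissipationLiouville.Unidirectional

end
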